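import Summits.BirchSwinnertonDyer.BirchSwinnertonDyer.Theorems.SchneiderFreeAdditiveX3PoitouTateUnramifiedOrthogonalAllLevels
import Literature.NumberTheory.GaloisCohomology.ArchimedeanInvariantMapLevelChange
import Literature.NumberTheory.GaloisCohomology.LocalInvariantMap
import Literature.NumberTheory.EllipticCurves.KummerSequenceConnecting
import HarnessLib

/-!
# Route `SchneiderFreeAdditiveX3` (K1 door), control corner: tools for the CRT reduction of Milne I
# Thm. 4.10(b) (`hE`) to prime-power LEVELS

Cell `bsd-schneider-ideate`, seat `bsd-schneider-door-c4` (prover, generation 9). PARTITION: board row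
B6 ∩ X3 ∩ sst-twist, `r = 1` — CONTROL corner (crux `AnticycControlAdditiveK`, stmt-BirchSwinnertonDyer-19295;
facts binder `ControlFacts` (i), stmt-19538); types-the-object-of the reduction
`hE(canonical K (ab)) ⟸ hE(canonical K a) ∧ hE(canonical K b)` (`a ⊥ b`, companion file
`…PoitouTateMiddleExactCoprime.lean`); closes nothing by itself.  Theorems only (the four maps are
produced by existence statements with their pointwise values, no definitions).
* §1 the maps as continuous `Γ_K`-intertwining maps (`→ⁱL`): `μ_a ⊆ μ_N`, `ι : M[a] ⊆ M`,
  `π = e· : M → M[a]` (`e ≡ 0 (b)`, `ab·M = 0`), `Ψ : Hom(M[a], μ_a) → Hom(M, μ_N)`, `g ↦ (μ_a ⊆ μ_N) ∘ g ∘ π`;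
* §2 **level change on LOCAL classes**, every place `v`: `inv_v^{(N)} ((μ_a ⊆ μ_N)_* z) = (N/a)·inv_v^{(a)}(z)`
  for THE invariant maps `LocalInvariants.canonical` (finite `v`: `Prop121vii.invariantMap_muInclHom_compat`
  for `K_v` through `muLocalIso`; infinite `v`: the diagonal, `0 ↦ 0`, `a/2 ↦ N/2`) — the tree had it for
  localisations of GLOBAL classes only (`canonical_localization_cohomologyMap_muInclHom`);
* §3 **`(μ_a ⊆ μ_N)_* (π_* t ∪_a y') = t ∪_N Ψ_* y'`** in `H²(K_v, μ_N)` for local `t ∈ H¹(K_v, M)`,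
  `y' ∈ H¹(K_v, Hom(M[a], μ_a))` (`ContPairing.cupProduct_map`), and its `ℤ/N`-valued form through §2.

References: [MilneADT2006] I §0, §2, 4.10(b); [SerreLocalFields1979] XIII §3; [NeukirchSchmidtWingberg2008] (1.4.2).
-/

noncomputable section

open CategoryTheory Function NumberField IsDedekindDomain
open scoped NumberField ContRepresentation

universe u

-- D-0017 layout: summit = sub-problem (`Summit.BirchSwinnertonDyer.BirchSwinnertonDyer.…`), as in the sockets files.
set_option linter.dupNamespace false
set_option autoImplicit false

namespace Summit.BirchSwinnertonDyer.BirchSwinnertonDyer.Theorems.SchneiderFreeAdditiveX3.PoitouTateReduction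

open Field
open Literature.NumberTheory.GaloisRepresentations Literature.NumberTheory.GaloisCohomology
open _root_.TopRep _root_.ContRepresentation _root_.ContinuousCohomology
open Literature.NumberTheory.GaloisRepresentations.DiscreteGaloisModule (mu MuCarrier TateDual tateDual
  tateDualPairingLocal localTatePairing localTatePairingZMod unramifiedSubgroup homOfIntertwining)

/-! ## §1. The four intertwining maps -/

section Maps

variable (K : Type u) [Field K]

/-- **`μ_a ⊆ μ_N` (`a ∣ N`) as a continuous `Γ_K`-intertwining map** (the tree's `muInclHom`, `→ⁱL` form).
[cite: MilneADT2006, Ch. I §0] -/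
theorem exists_muIncl_intertwining {a N : ℕ} (haN : a ∣ N) :
    ∃ j : (mu K a).toContRepresentation →ⁱL (mu K N).toContRepresentation,
      ∀ ζ : MuCarrier K a, j ζ = muInclusion K haN ζ := by
  refine ⟨{ toContinuousLinearMap := ⟨(muInclusion K haN).toIntLinearMap, continuous_of_discreteTopology⟩
            isIntertwining' := fun σ => ContinuousLinearMap.ext fun ζ => ?_ }, fun ζ => rfl⟩
  change muInclusion K haN (mu K a σ ζ) = mu K N σ (muInclusion K haN ζ)
  apply muVal_injective K N
  rw [muVal_muInclusion, muVal_apply, muVal_apply, muVal_muInclusion]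

variable {K} {M : Type u} [AddCommGroup M] [TopologicalSpace M] [DiscreteTopology M]
  (ρ : DiscreteGaloisModule K M)

/-- **`ι : M[a] ⊆ M` as a continuous `Γ_K`-intertwining map** (the tree's `torsionIncl`, `→ⁱL` form).
[cite: MilneADT2006, Ch. I §0] -/
theorem exists_torsionIncl_intertwining (a : ℕ) :
    ∃ ι : (ρ.torsionRep a).toContRepresentation →ⁱL ρ.toContRepresentation,
      ∀ x : Submodule.torsionBy ℤ M (a : ℤ), ι x = (x : M) := by
  refine ⟨{ toContinuousLinearMap := ⟨(Submodule.torsionBy ℤ M (a : ℤ)).subtype, continuous_subtype_val⟩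
            isIntertwining' := fun σ => ContinuousLinearMap.ext fun x => ?_ }, fun x => rfl⟩
  rfl

/-- **`π = e· : M → M[a]` as a continuous `Γ_K`-intertwining map** (`e ≡ 0 (b)`, `ab·M = 0`; the tree's
`torsionProj`, `→ⁱL` form). [cite: MilneADT2006, Ch. I §0] -/
theorem exists_torsionProj_intertwining {a b e : ℕ} (he0 : e ≡ 0 [MOD b])
    (hM : ∀ m : M, (a * b) • m = 0) :
    ∃ π : ρ.toContRepresentation →ⁱL (ρ.torsionRep a).toContRepresentation,
      ∀ m : M, (π m : M) = e • m := by
  have hmem : ∀ m : M, e • m ∈ Submodule.torsionBy ℤ M (a : ℤ) := fun m =>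
    (ContinuousRep.mem_torsionBy_nsmul_iff a).2 (nsmul_nsmul_eq_zero_of_modEq_zero he0 (hM m))
  refine ⟨{ toContinuousLinearMap :=
              ⟨{ toFun := fun m => ⟨e • m, hmem m⟩
                 map_add' := fun m m' => Subtype.ext (nsmul_add m m' e)
                 map_smul' := fun c m => Subtype.ext (by
                   change e • (c • m) = c • (e • m)
                   exact smul_comm e c m) }, continuous_of_discreteTopology⟩
            isIntertwining' := fun σ => ContinuousLinearMap.ext fun m => Subtype.ext ?_ }, fun m => rfl⟩
  change e • ρ σ m = ρ σ (e • m)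
  rw [map_nsmul]

/-- **`Ψ : Hom(M[a], μ_a) → Hom(M, μ_N)`, `g ↦ (μ_a ⊆ μ_N) ∘ g ∘ (e·)`, as a continuous `Γ_K`-intertwining
map of Tate duals** (`a ∣ N`, `e ≡ 0 (b)`, `ab·M = 0`). [cite: MilneADT2006, Ch. I §0 (M^D = Hom(M, μ))] -/
theorem exists_tateDual_extend_intertwining [Finite M] {a b e N : ℕ} (haN : a ∣ N)
    (he0 : e ≡ 0 [MOD b]) (hM : ∀ m : M, (a * b) • m = 0) :
    ∃ Ψ : (tateDual (ρ.torsionRep a) a).toContRepresentation →ⁱL (ρ.tateDual N).toContRepresentation,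
      ∀ (g : TateDual K (Submodule.torsionBy ℤ M (a : ℤ)) a) (m : M),
        Ψ g m = muInclusion K haN (g ⟨e • m, (ContinuousRep.mem_torsionBy_nsmul_iff a).2
          (nsmul_nsmul_eq_zero_of_modEq_zero he0 (hM m))⟩) := by
  have hmem : ∀ m : M, e • m ∈ Submodule.torsionBy ℤ M (a : ℤ) := fun m =>
    (ContinuousRep.mem_torsionBy_nsmul_iff a).2 (nsmul_nsmul_eq_zero_of_modEq_zero he0 (hM m))
  -- the projection `e·` as an additive map
  let πadd : M →+ Submodule.torsionBy ℤ M (a : ℤ) :=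
    { toFun := fun m => ⟨e • m, hmem m⟩
      map_zero' := Subtype.ext (nsmul_zero e)
      map_add' := fun m m' => Subtype.ext (nsmul_add m m' e) }
  -- the extension on carriers
  let Ψadd : TateDual K (Submodule.torsionBy ℤ M (a : ℤ)) a →+ TateDual K M N :=
    { toFun := fun g => ((muInclusion K haN).comp
        ((g : Submodule.torsionBy ℤ M (a : ℤ) →+ MuCarrier K a).comp πadd) : M →+ MuCarrier K N)
      map_zero' := DiscreteGaloisModule.TateDual.ext fun m => by
        change muInclusion K haN ((0 : TateDual K _ a) (πadd m)) = 0
        rw [DiscreteGaloisModule.TateDual.zero_apply]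
        exact map_zero (muInclusion K haN)
      map_add' := fun g g' => DiscreteGaloisModule.TateDual.ext fun m => by
        change muInclusion K haN ((g + g') (πadd m)) =
          muInclusion K haN (g (πadd m)) + muInclusion K haN (g' (πadd m))
        rw [DiscreteGaloisModule.TateDual.add_apply]
        exact map_add (muInclusion K haN) _ _ }
  have hΨ : ∀ (g : TateDual K (Submodule.torsionBy ℤ M (a : ℤ)) a) (m : M),
      Ψadd g m = muInclusion K haN (g ⟨e • m, hmem m⟩) := fun g m => rfl
  refine ⟨{ toContinuousLinearMap := ⟨Ψadd.toIntLinearMap, continuous_of_discreteTopology⟩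
            isIntertwining' := fun σ => ContinuousLinearMap.ext fun g =>
              DiscreteGaloisModule.TateDual.ext fun m => ?_ }, fun g m => rfl⟩
  change Ψadd (tateDual (ρ.torsionRep a) a σ g) m = ρ.tateDual N σ (Ψadd g) m
  rw [hΨ, DiscreteGaloisModule.tateDual_apply_apply_apply, DiscreteGaloisModule.tateDual_apply_apply_apply,
    hΨ]
  have hπ : (ρ.torsionRep a) σ⁻¹ ⟨e • m, hmem m⟩ = ⟨e • ρ σ⁻¹ m, hmem _⟩ :=
    Subtype.ext (by rw [ContinuousRep.subrepresentation_apply_coe]; exact map_nsmul (ρ σ⁻¹) e m)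
  rw [hπ]
  apply muVal_injective K N
  rw [muVal_muInclusion, muVal_apply, muVal_apply, muVal_muInclusion]

end Maps

/-! ## §2. Level change of THE invariant maps along `μ_a ⊆ μ_N` on LOCAL classes, every place -/

section LevelChange

open Literature.AnabelianGeometry.AbsoluteAnabelian
open Literature.AnabelianGeometry.AbsoluteAnabelian.Prop121vii

variable {K : Type u} [Field K] [NumberField K] {a N : ℕ} [NeZero a] [NeZero N]

/-- The only non-zero element of `ℤ/n` killed by `2` is `n/2` (and then `n` is even); for an additive
isomorphism `A ≃ ℤ/n`. (Copy of the tree's private helper of `ArchimedeanInvariantMapLevelChange`.)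
[folklore] -/
private theorem addEquiv_apply_eq_natCast_div_two' {A : Type*} [AddCommGroup A] {n : ℕ} [NeZero n]
    (e : A ≃+ ZMod n) {x : A} (hx2 : 2 • x = 0) (hx0 : x ≠ 0) :
    e x = ((n / 2 : ℕ) : ZMod n) ∧ 2 ∣ n := by
  have h2 : 2 • e x = 0 := by rw [← map_nsmul, hx2, map_zero]
  have h0 : e x ≠ 0 := by rw [ne_eq, e.map_eq_zero_iff]; exact hx0
  have hlt : (e x).val < n := ZMod.val_lt _
  have hpos : 0 < (e x).val := Nat.pos_of_ne_zero fun h => h0 ((ZMod.val_eq_zero _).mp h)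
  have h2' : ((2 * (e x).val : ℕ) : ZMod n) = 0 := by
    rw [two_mul, Nat.cast_add, ZMod.natCast_zmod_val, ← two_nsmul]
    exact h2
  obtain ⟨k, hk⟩ := (ZMod.natCast_eq_zero_iff _ _).mp h2'
  have hk1 : k = 1 := by
    rcases Nat.lt_or_ge k 2 with hk2 | hk2
    · interval_cases k
      · omega
      · rfl
    · have : n * 2 ≤ n * k := Nat.mul_le_mul_left n hk2
      omega
  subst hk1
  rw [mul_one] at hk
  refine ⟨?_, ⟨(e x).val, by omega⟩⟩
  have hv : (e x).val = n / 2 := by omega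
  rw [← hv, ZMod.natCast_zmod_val]

/-- `(a/2)·(N/a) = N/2` for `a` even dividing `N`. [folklore] -/
private theorem div_two_mul_div' (h2 : 2 ∣ a) (hN : a ∣ N) : a / 2 * (N / a) = N / 2 := by
  obtain ⟨c, rfl⟩ := h2
  obtain ⟨k, rfl⟩ := hN
  rw [Nat.mul_div_cancel_left c two_pos, Nat.mul_div_cancel_left k (NeZero.pos (2 * c)), mul_assoc,
    Nat.mul_div_cancel_left (c * k) two_pos]

/-- **Level change on LOCAL classes at a finite place**: for `a ∣ N`, a finite place `v` and a local class
`z ∈ H²(K_v, μ_a)`, THE invariant maps satisfy `inv_v^{(N)} ((μ_a ⊆ μ_N)_* z) = (N/a) · inv_v^{(a)} (z)`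
in `ℤ/N` — the residue maps of `K_v` at levels `a ∣ N` are compatible inside `ℚ/ℤ`
(`Prop121vii.invariantMap_muInclHom_compat` for `K_v`, transported through `muLocalIso`:
`μ_a(K̄)|_{Γ_{K_v}} ≅ μ_a(K̄_v)` commutes with the inclusions).  The tree's
`localInvariantMap_localization_cohomologyMap_muInclHom` is the case of localisations of global classes.
[cite: SerreLocalFields1979, XIII §3 Cor. 3] -/
theorem localInvariantMap_map_muIncl (haN : a ∣ N)
    (j : (mu K a).toContRepresentation →ⁱL (mu K N).toContRepresentation)
    (hj : ∀ ζ : MuCarrier K a, j ζ = muInclusion K haN ζ) (v : HeightOneSpectrum (𝓞 K))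
    (z : galoisCohomology ((mu K a).toLocal (Sum.inr v)) 2) :
    localInvariantMap K N v (galoisCohomology.map (j.restrictField (Place.Completion (Sum.inr v))) 2 z) =
      (((localInvariantMap K a v z).val * (N / a) : ℕ) : ZMod N) := by
  haveI : CharZero (v.adicCompletion K) := charZero_adicCompletion v
  haveI : CompactSpace (absoluteGaloisGroup (v.adicCompletion K)) := absoluteGaloisGroup_compactSpace _
  haveI := Literature.NumberTheory.GaloisRepresentations.finite_muCarrier (v.adicCompletion K) a
  haveI := Literature.NumberTheory.GaloisRepresentations.finite_muCarrier (v.adicCompletion K) N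
  rw [localInvariantMap_apply, localInvariantMap_apply]
  -- the naturality square `muLocalIso_N ∘ j = muInclHom_{K_v} ∘ muLocalIso_a` on `H²`
  set jv := homOfIntertwining (j.restrictField (Place.Completion (K := K) (Sum.inr v))) with hjv
  have h1 : (cohomologyMap (muLocalIso v N).hom 2).hom
      (galoisCohomology.map (j.restrictField (Place.Completion (Sum.inr v))) 2 z) =
        cohomologyMap (jv ≫ (muLocalIso v N).hom) 2 z :=
    (map_comp_apply_of (ContinuousMonoidHom.id _) (ContinuousMonoidHom.id _) (ContinuousMonoidHom.id _)
      (fun _ => rfl) (resIdHom jv) (resIdHom (muLocalIso v N).hom) (resIdHom (jv ≫ (muLocalIso v N).hom))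
      (fun _ => rfl) 2 z).symm
  have h2 : cohomologyMap (muInclHom (v.adicCompletion K) haN) 2 ((cohomologyMap (muLocalIso v a).hom 2).hom z) =
      cohomologyMap (jv ≫ (muLocalIso v N).hom) 2 z := by
    refine (map_comp_apply_of (ContinuousMonoidHom.id _) (ContinuousMonoidHom.id _) (ContinuousMonoidHom.id _)
      (fun _ => rfl) (resIdHom (muLocalIso v a).hom) (resIdHom (muInclHom (v.adicCompletion K) haN))
      (resIdHom (jv ≫ (muLocalIso v N).hom)) (fun x => ?_) 2 z).symm
    change muTransfer K (v.adicCompletion K) N (j x) =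
      muInclusion (v.adicCompletion K) haN (muTransfer K (v.adicCompletion K) a x)
    rw [hj]
    apply muVal_injective (v.adicCompletion K) N
    rw [muVal_muTransfer, muVal_muInclusion, muVal_muInclusion, muVal_muTransfer]
  rw [h1, ← h2]
  exact invariantMap_muInclHom_compat (v.adicCompletion K) haN _ _ (isInvariantMap_invLevel _ a)
    (isInvariantMap_invLevel _ N) _

/-- **Level change on LOCAL classes at an infinite place**: for `a ∣ N`, an infinite place `w` and
`z ∈ H²(K_w, μ_a)`, `inv_w^{(N)} ((μ_a ⊆ μ_N)_* z) = (N/a) · inv_w^{(a)} (z)` in `ℤ/N`: the diagonal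
`φ(c, c) + φ(1, 1) ∈ μ_a[2]` of a cocycle goes to its image in `μ_N[2]`, `0 ↦ 0` and `a/2 ↦ N/2`.  The
tree's `archimedeanInvariantMap_localization_cohomologyMap_muInclHom` is the case of localisations of
global classes. [cite: MilneADT2006, Ch. I, Ex. 1.6 (c)] [cite: SerreLocalFields1979, XIII §3 Cor. 3] -/
theorem archimedeanInvariantMap_map_muIncl (haN : a ∣ N)
    (j : (mu K a).toContRepresentation →ⁱL (mu K N).toContRepresentation)
    (hj : ∀ ζ : MuCarrier K a, j ζ = muInclusion K haN ζ) (w : InfinitePlace K)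
    (z : galoisCohomology ((mu K a).toLocal (Sum.inl w)) 2) :
    archimedeanInvariantMap K N w (galoisCohomology.map (j.restrictField (Place.Completion (Sum.inl w))) 2 z) =
      (((archimedeanInvariantMap K a w z).val * (N / a) : ℕ) : ZMod N) := by
  haveI : CompactSpace (absoluteGaloisGroup (Place.Completion (K := K) (Sum.inl w))) :=
    absoluteGaloisGroup_compactSpace _
  haveI := finite_absoluteGaloisGroup_placeCompletion_inl K w
  have hG := natCard_absoluteGaloisGroup_placeCompletion_inl_le_two K w
  obtain ⟨φ, rfl⟩ := twoCocycleClass_surjective ((mu K a).toLocal (Sum.inl w)).toTopRep z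
  have hmap : galoisCohomology.map (j.restrictField (Place.Completion (Sum.inl w))) 2
      (twoCocycleClass ((mu K a).toLocal (Sum.inl w)).toTopRep φ) =
        twoCocycleClass ((mu K N).toLocal (Sum.inl w)).toTopRep (contTwoCocycles.pullback (ContinuousMonoidHom.id _)
          (resIdHom (homOfIntertwining (j.restrictField (Place.Completion (K := K) (Sum.inl w))))) φ) :=
    cohomologyMap_twoCocycleClass _ φ
  rw [hmap, archimedeanInvariantMap_twoCocycleClass, archimedeanInvariantMap_twoCocycleClass]
  by_cases htriv : ∀ σ : absoluteGaloisGroup (Place.Completion (K := K) (Sum.inl w)), σ = 1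
  · rw [twoCocycleDiagonal_of_forall_eq_one htriv, twoCocycleDiagonal_of_forall_eq_one htriv, map_zero,
      map_zero, ZMod.val_zero, zero_mul, Nat.cast_zero]
  simp only [not_forall] at htriv
  obtain ⟨c, hc⟩ := htriv
  set D : MuCarrier K a := φ.1 (c, c) + φ.1 (1, 1) with hD
  have hdiag : twoCocycleDiagonal _ φ = D := twoCocycleDiagonal_of_ne_one hG hc φ
  have hdiag' : twoCocycleDiagonal ((mu K N).toLocal (Sum.inl w)).toTopRep (contTwoCocycles.pullback
      (ContinuousMonoidHom.id _) (resIdHom (homOfIntertwining (j.restrictField (Place.Completion (K := K) (Sum.inl w)))))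
      φ) = muInclusion K haN D := by
    rw [twoCocycleDiagonal_of_ne_one hG hc]
    change j (φ.1 (c, c)) + j (φ.1 (1, 1)) = muInclusion K haN D
    rw [hj, hj, ← map_add]
  rw [hdiag, hdiag']
  -- `2 • D = 0` (the archimedean invariant is `2`-torsion)
  have hD2 : 2 • D = 0 := by
    apply (muCarrierZModEquiv K a).injective
    rw [map_nsmul, map_zero, ← hdiag, ← archimedeanInvariantMap_twoCocycleClass]
    exact two_nsmul_archimedeanInvariantMap _
  by_cases hD0 : D = 0
  · rw [hD0, map_zero, map_zero, map_zero, ZMod.val_zero, zero_mul, Nat.cast_zero]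
  obtain ⟨hDa, h2a⟩ := addEquiv_apply_eq_natCast_div_two' (muCarrierZModEquiv K a) hD2 hD0
  have hιD0 : muInclusion K haN D ≠ 0 := by
    intro h
    apply hD0
    apply muVal_injective K a
    rw [← muVal_muInclusion K haN D, h, muVal_zero, muVal_zero]
  have hιD2 : 2 • muInclusion K haN D = 0 := by rw [← map_nsmul, hD2, map_zero]
  obtain ⟨hDN, -⟩ := addEquiv_apply_eq_natCast_div_two' (muCarrierZModEquiv K N) hιD2 hιD0
  rw [hDN, hDa, ZMod.val_natCast, Nat.mod_eq_of_lt (Nat.div_lt_self (NeZero.pos a) one_lt_two),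
    div_two_mul_div' h2a haN]

/-- **Level change of THE invariant maps `LocalInvariants.canonical` along `μ_a ⊆ μ_N` on LOCAL classes,
every place `v`**: `inv_v^{(N)} ((μ_a ⊆ μ_N)_* z) = (N/a) · inv_v^{(a)} (z)` in `ℤ/N`.
[cite: SerreLocalFields1979, XIII §3 Cor. 3] [cite: MilneADT2006, Ch. I, Ex. 1.6 (c)] -/
theorem canonical_map_muIncl (haN : a ∣ N)
    (j : (mu K a).toContRepresentation →ⁱL (mu K N).toContRepresentation)
    (hj : ∀ ζ : MuCarrier K a, j ζ = muInclusion K haN ζ) (v : Place K)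
    (z : galoisCohomology ((mu K a).toLocal v) 2) :
    LocalInvariants.canonical K N v (galoisCohomology.map (j.restrictField (Place.Completion v)) 2 z) =
      (((LocalInvariants.canonical K a v z).val * (N / a) : ℕ) : ZMod N) := by
  rcases v with w | v
  · rw [LocalInvariants.canonical_inl, LocalInvariants.canonical_inl]
    exact archimedeanInvariantMap_map_muIncl haN j hj w z
  · rw [LocalInvariants.canonical_inr, LocalInvariants.canonical_inr]
    exact localInvariantMap_map_muIncl haN j hj v z

end LevelChange

/-! ## §3. The local Tate pairings of `M[a]` (level `a`) and `M` (level `N`) -/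

section CupCompat

variable {K : Type u} [Field K] [NumberField K]
  {M : Type u} [AddCommGroup M] [TopologicalSpace M] [DiscreteTopology M] [Finite M]
  (ρ : DiscreteGaloisModule K M) {a b e N : ℕ}

/-- **`(μ_a ⊆ μ_N)_* (π_* t ∪_a y') = t ∪_N Ψ_* y'` in `H²(K_v, μ_N)`** for a local class
`t ∈ H¹(K_v, M)` and `y' ∈ H¹(K_v, Hom(M[a], μ_a))`, where `π = e·`, `ι : M[a] ⊆ M`,
`Ψ g = (μ_a ⊆ μ_N) ∘ g ∘ π` (`a ⊥ b`, `e ≡ 1 (a)`, `e ≡ 0 (b)`, `ab·M = 0`, `a ∣ N`): naturality of the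
cup product (`ContPairing.cupProduct_map` for `(ι, Ψ, μ_a ⊆ μ_N)`: `(Ψ g)(ι x) = (μ_a ⊆ μ_N)(g x)` as
`e x = x` on `M[a]`), then `ι_* π_* t = e·t` and `e` acts as `1` on the `a`-torsion class `t ∪ Ψ_* y'`.
[cite: NeukirchSchmidtWingberg2008, I §4 (1.4.2)] [cite: MilneADT2006, Ch. I, Cor. 2.3] -/
theorem localTatePairing_map_torsionProj (he1 : e ≡ 1 [MOD a]) (he0 : e ≡ 0 [MOD b])
    (hM : ∀ m : M, (a * b) • m = 0) (haN : a ∣ N)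
    (ι : (ρ.torsionRep a).toContRepresentation →ⁱL ρ.toContRepresentation)
    (hι : ∀ x : Submodule.torsionBy ℤ M (a : ℤ), ι x = (x : M))
    (π : ρ.toContRepresentation →ⁱL (ρ.torsionRep a).toContRepresentation)
    (hπ : ∀ m : M, (π m : M) = e • m)
    (Ψ : (tateDual (ρ.torsionRep a) a).toContRepresentation →ⁱL (ρ.tateDual N).toContRepresentation)
    (hΨ : ∀ (g : TateDual K (Submodule.torsionBy ℤ M (a : ℤ)) a) (m : M),
      Ψ g m = muInclusion K haN (g ⟨e • m, (ContinuousRep.mem_torsionBy_nsmul_iff a).2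
        (nsmul_nsmul_eq_zero_of_modEq_zero he0 (hM m))⟩))
    (j : (mu K a).toContRepresentation →ⁱL (mu K N).toContRepresentation)
    (hj : ∀ ζ : MuCarrier K a, j ζ = muInclusion K haN ζ) (v : Place K)
    (t : galoisCohomology (ρ.toLocal v) 1)
    (y' : galoisCohomology ((tateDual (ρ.torsionRep a) a).toLocal v) 1) :
    galoisCohomology.map (j.restrictField (Place.Completion v)) 2
        (localTatePairing (ρ.torsionRep a) a v
          (galoisCohomology.map (π.restrictField (Place.Completion v)) 1 t) y') =
      localTatePairing ρ N v t (galoisCohomology.map (Ψ.restrictField (Place.Completion v)) 1 y') := by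
  haveI : CompactSpace (absoluteGaloisGroup (Place.Completion (K := K) v)) := absoluteGaloisGroup_compactSpace _
  set E := Place.Completion (K := K) v with hE
  set P₁ := tateDualPairingLocal (ρ.torsionRep a) a v with hP₁
  set P₂ := tateDualPairingLocal ρ N v with hP₂
  set ιE := homOfIntertwining (ι.restrictField E) with hιE
  set πE := homOfIntertwining (π.restrictField E) with hπE
  set ΨE := homOfIntertwining (Ψ.restrictField E) with hΨE
  set jE := homOfIntertwining (j.restrictField E) with hjE
  -- naturality of the cup product for `(ι, Ψ, μ_a ⊆ μ_N)`
  have hc : ∀ (x : Submodule.torsionBy ℤ M (a : ℤ)) (g : TateDual K (Submodule.torsionBy ℤ M (a : ℤ)) a),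
      jE.hom (P₁.toLin x g) = P₂.toLin (ιE.hom x) (ΨE.hom g) := by
    intro x g
    change j (g x) = Ψ g (ι x)
    rw [hj, hι, hΨ]
    congr 2
    apply Subtype.ext
    have h := congrArg Subtype.val (nsmul_eq_self_of_modEq_one he1 (nsmul_torsionRep_eq_zero a x))
    rw [Submodule.coe_smul_of_tower] at h
    exact h.symm
  have hnat := ContPairing.cupProduct_map P₁ P₂ ιE ΨE jE hc (cohomologyMap πE 1 t) y'
  -- `ι_* π_* t = e • t`
  have hιπ : cohomologyMap ιE 1 (cohomologyMap πE 1 t) = e • t := by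
    rw [← map_comp_apply_of (ContinuousMonoidHom.id _) (ContinuousMonoidHom.id _) (ContinuousMonoidHom.id _)
        (fun _ => rfl) (resIdHom πE) (resIdHom ιE) (resIdHom (πE ≫ ιE)) (fun _ => rfl) 1 t]
    refine cohomologyMap_one_eq_nsmul (ρ.toLocal v) _ e (fun m => ?_) t
    change ι (π m) = e • m
    rw [hι, hπ]
  -- `e` acts as `1` on `t ∪ Ψ_* y'` (`y'`, hence `Ψ_* y'`, is `a`-torsion)
  have hy0 : a • y' = 0 :=
    nsmul_continuousCohomology_one_eq_zero _ a (fun g => DiscreteGaloisModule.TateDual.ext fun x => by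
      change a • g x = 0
      rw [← map_nsmul, nsmul_torsionRep_eq_zero, map_zero]) y'
  have hey : cohomologyMap ΨE 1 (e • y') = cohomologyMap ΨE 1 y' :=
    congrArg (fun z => cohomologyMap ΨE 1 z) (nsmul_eq_self_of_modEq_one he1 hy0)
  have hey' : e • cohomologyMap ΨE 1 y' = cohomologyMap ΨE 1 y' :=
    (map_nsmul (ConcreteCategory.hom (cohomologyMap ΨE 1)) e y').symm.trans hey
  refine hnat.trans ?_
  refine (congrArg (fun z => P₂.cupProduct z (cohomologyMap ΨE 1 y')) hιπ).trans ?_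
  have h4 : P₂.cupProduct (e • t) (cohomologyMap ΨE 1 y') = e • P₂.cupProduct t (cohomologyMap ΨE 1 y') :=
    (congrArg (fun φ => φ (cohomologyMap ΨE 1 y')) (map_nsmul P₂.cupProduct e t)).trans
      (LinearMap.smul_apply e (P₂.cupProduct t) (cohomologyMap ΨE 1 y'))
  have h5 : e • P₂.cupProduct t (cohomologyMap ΨE 1 y') = P₂.cupProduct t (cohomologyMap ΨE 1 y') :=
    (map_nsmul (P₂.cupProduct t) e _).symm.trans (congrArg (fun z => P₂.cupProduct t z) hey')
  exact h4.trans h5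

/-- **The `ℤ/N`-valued form through THE invariant maps**: for every place `v`,
`inv_v^{(N)} (t ∪_N Ψ_* y') = (N/a) · inv_v^{(a)} (π_* t ∪_a y')` (`localTatePairing_map_torsionProj` and the
level change `canonical_map_muIncl`). [cite: MilneADT2006, Ch. I, Cor. 2.3 and Thm. 4.10(b)] -/
theorem localTatePairingZMod_canonical_map_torsionProj [NeZero a] [NeZero N] (he1 : e ≡ 1 [MOD a])
    (he0 : e ≡ 0 [MOD b]) (hM : ∀ m : M, (a * b) • m = 0) (haN : a ∣ N)
    (ι : (ρ.torsionRep a).toContRepresentation →ⁱL ρ.toContRepresentation)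
    (hι : ∀ x : Submodule.torsionBy ℤ M (a : ℤ), ι x = (x : M))
    (π : ρ.toContRepresentation →ⁱL (ρ.torsionRep a).toContRepresentation)
    (hπ : ∀ m : M, (π m : M) = e • m)
    (Ψ : (tateDual (ρ.torsionRep a) a).toContRepresentation →ⁱL (ρ.tateDual N).toContRepresentation)
    (hΨ : ∀ (g : TateDual K (Submodule.torsionBy ℤ M (a : ℤ)) a) (m : M),
      Ψ g m = muInclusion K haN (g ⟨e • m, (ContinuousRep.mem_torsionBy_nsmul_iff a).2
        (nsmul_nsmul_eq_zero_of_modEq_zero he0 (hM m))⟩))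
    (j : (mu K a).toContRepresentation →ⁱL (mu K N).toContRepresentation)
    (hj : ∀ ζ : MuCarrier K a, j ζ = muInclusion K haN ζ) (v : Place K)
    (t : galoisCohomology (ρ.toLocal v) 1)
    (y' : galoisCohomology ((tateDual (ρ.torsionRep a) a).toLocal v) 1) :
    localTatePairingZMod ρ N v (LocalInvariants.canonical K N v) t
        (galoisCohomology.map (Ψ.restrictField (Place.Completion v)) 1 y') =
      (((localTatePairingZMod (ρ.torsionRep a) a v (LocalInvariants.canonical K a v)
          (galoisCohomology.map (π.restrictField (Place.Completion v)) 1 t) y').val * (N / a) : ℕ) : ZMod N) := by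
  rw [DiscreteGaloisModule.localTatePairingZMod_apply, DiscreteGaloisModule.localTatePairingZMod_apply,
    ← localTatePairing_map_torsionProj ρ he1 he0 hM haN ι hι π hπ Ψ hΨ j hj v t y',
    canonical_map_muIncl haN j hj v]

end CupCompat

end Summit.BirchSwinnertonDyer.BirchSwinnertonDyer.Theorems.SchneiderFreeAdditiveX3.PoitouTateReduction

end
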